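import Summits.BirchSwinnertonDyer.BirchSwinnertonDyer.Theses.CongruentShaFreeCut
import Literature.NumberTheory.EllipticCurves.FanWan2023.NonsplitPConverseClaims
import Literature.NumberTheory.EllipticCurves.BSDSelmerCMPConverseRankOneProofs

/-! # Route `CongruentShaFreeCut` (rung S2) — crux `AnalyticRankOneOfRankOneFiniteShaTwo`
(stmt-BirchSwinnertonDyer-19080) under the two CLAIMED proofs in print (bookkeeping, nothing refereed
is discharged)

Crux B = `rank E_n(ℚ) = 1 ∧ #Ш(E_n/ℚ)[2^∞] < ∞ ⟹ ord_{s=1} L(E_n, s) = 1` is the Ш-finite half of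
the rung-S2 leaf `rankOne_twoConverse_congruentNumber` (`corank_{ℤ₂} Sel_{2^∞}(E_n) = 1 ⟹ ord = 1`)
and follows from it OUTRIGHT (Greenberg's identity, tree theorem
`selmerCorank_eq_one_of_mordellWeilRank_eq_one_of_finite`, per curve: `analyticRank_eq_one_of_corankForm`). The leaf is claimed —
not refereed — twice in print, and both claims are NAMED HYPOTHESES of the tree: Kříž,
arXiv:2002.04767v5, Thm. 10.13 (`kriz_analyticRank_eq_one_of_selmerCorank_eq_one_of_cmRamified`,
`Kriz2020/RankOnePConverse.lean`) and Fan–Wan, arXiv:2304.09806v2, Thm. 1.1 / Thm. 6.9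
(`FanWan2023.thmM_…_CLAIMED`, `FanWan2023.thm69_…_CLAIMED`, typed 2026-08-26 by seat bsd-cn100-ty,
p417677). This file records crux B under each claim (`cruxB_of_kriz`, `cruxB_of_thmM_CLAIMED`,
`cruxB_of_thm69_CLAIMED_of_parity`) so that the tree states, kernel-checked, WHERE crux B sits: a
consequence of either unrefereed manuscript, of no refereed one (cell verdicts HOME/VERDICT.md,
GAP-LEDGER-read1/read2; the seat's find-verdict HOME/bsd-cn100-s2-c3/T3-MEMO-crux-B-two-leaves.md).
Every theorem here is CONDITIONAL on a claim binder; none is progress on the crux. Supports, does not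
close, stmt-BirchSwinnertonDyer-19080. -/

namespace Summit.BirchSwinnertonDyer.BirchSwinnertonDyer.Theorems.CongruentShaFreeCutOfClaims

open Literature.NumberTheory.EllipticCurves WeierstrassCurve
open Summit.BirchSwinnertonDyer.BirchSwinnertonDyer.Theses.CongruentShaFreeCut

/-- From a corank-form statement `corank_{ℤ₂} Sel_{2^∞}(E_n) = 1 ⟹ ord_{s=1} L(E_n,s) = 1` at ONE
`n ≠ 0` to the Ш-finite form at that `n`: `rank = 1 ∧ #Ш[2^∞] < ∞ ⟹ corank_{ℤ₂} = 1` (Greenberg,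
tree theorem `selmerCorank_eq_one_of_mordellWeilRank_eq_one_of_finite`). Stated per curve and with
the conclusion unfolded on purpose: the leaf-to-crux direction is converse bookkeeping (cf.
`CongruentShaFreeCutLeafConverse.leaf_iff_cruxes_of_gzk`), not a theorem with a route decl as type.
[folklore] -/
theorem analyticRank_eq_one_of_corankForm {n : ℕ} (hn : n ≠ 0)
    (hcor : (congruentNumberCurve n).selmerCorank 2 = 1 → (congruentNumberCurve n).analyticRank = 1)
    (hrank : (congruentNumberCurve n).mordellWeilRank = 1)
    (hsha : Finite (AddCommGroup.primaryComponent (congruentNumberCurve n).sha 2)) :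
    (congruentNumberCurve n).analyticRank = 1 := by
  haveI := isElliptic_congruentNumberCurve hn
  haveI : Fact (Nat.Prime 2) := ⟨Nat.prime_two⟩
  exact hcor (selmerCorank_eq_one_of_mordellWeilRank_eq_one_of_finite _ 2 hrank hsha)

/-- **Crux B under Kříž's claim** (arXiv:2002.04767v5 Thm. 10.13, the tree HYPOTHESIS
`kriz_analyticRank_eq_one_of_selmerCorank_eq_one_of_cmRamified`; unrefereed): via the tree theorem
`rankOne_twoConverse_congruentNumber_of_cmRamified` and `analyticRank_eq_one_of_corankForm`.
[claim: Kriz2020, status: under-review] -/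
theorem cruxB_of_kriz (hK : kriz_analyticRank_eq_one_of_selmerCorank_eq_one_of_cmRamified) :
    AnalyticRankOneOfRankOneFiniteShaTwo :=
  fun _ hn => analyticRank_eq_one_of_corankForm hn
    (rankOne_twoConverse_congruentNumber_of_cmRamified hK hn)

/-- **Crux B under Fan–Wan's Thm. 1.1 claim** (arXiv:2304.09806v2 [ThmM]; typed
`FanWan2023.thmM_analyticRank_eq_one_of_selmerCorank_eq_one_CLAIMED`, unrefereed): via
`FanWan2023.rankOne_twoConverse_congruentNumber_of_thmM_CLAIMED` and `analyticRank_eq_one_of_corankForm`.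
[claim: FanWan2023, status: under-review] -/
theorem cruxB_of_thmM_CLAIMED
    (hFW : FanWan2023.thmM_analyticRank_eq_one_of_selmerCorank_eq_one_CLAIMED) :
    AnalyticRankOneOfRankOneFiniteShaTwo :=
  fun _ hn => analyticRank_eq_one_of_corankForm hn
    (FanWan2023.rankOne_twoConverse_congruentNumber_of_thmM_CLAIMED hFW hn)

/-- **Crux B under Fan–Wan's Thm. 6.9 claim and `2`-parity** (arXiv:2304.09806v2, main
proposition, typed `FanWan2023.thm69_…_CLAIMED`, unrefereed; `hpar` = the `p`-parity theorem,
Dokchitser–Dokchitser 2010, supplying the sign `−1`): via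
`FanWan2023.rankOne_twoConverse_congruentNumber_of_thm69_CLAIMED_of_parity` and `analyticRank_eq_one_of_corankForm`.
[claim: FanWan2023, status: under-review] [cite: DokchitserDokchitserAnnals2010, Thm. 1.4] -/
theorem cruxB_of_thm69_CLAIMED_of_parity
    (h69 : FanWan2023.thm69_analyticRank_eq_one_of_selmerCorank_eq_one_of_not_cmSplit_CLAIMED)
    (hpar : ∀ (W : WeierstrassCurve ℚ) [W.IsElliptic] (p : ℕ) [Fact p.Prime], p_parity W p) :
    AnalyticRankOneOfRankOneFiniteShaTwo :=
  fun _ hn => analyticRank_eq_one_of_corankForm hn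
    (FanWan2023.rankOne_twoConverse_congruentNumber_of_thm69_CLAIMED_of_parity h69 hpar hn)

end Summit.BirchSwinnertonDyer.BirchSwinnertonDyer.Theorems.CongruentShaFreeCutOfClaims
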